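/-
Copyright: statement-level skeleton of a published paper (lit-balaban cell, Phase-2 proof seat p13, gen 9). No proof
claims beyond what the kernel checks below.
-/
import Literature.MathematicalPhysics.QuantumFieldTheory.BalabanImbrieJaffe1984to88.BIJ88Expansion577Bounds

/-!
# `BalabanImbrieJaffe1984to88.BIJ88WSplit290` — T. Bałaban, J. Imbrie, A. Jaffe, *Effective action and cluster properties
of the abelian Higgs model*, Commun. Math. Phys. **114** (1988) 257–315 [BalabanImbrieJaffe1988]: Sect. 5.7, p. 290, the
split of the interaction term of (5.7.2): *"Next we examine the propagators, and expand in V_j to all orders: G_j(Ω, u_{k+1}ũ̃) =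
G_j(Ω, u_{k+1}) + Σ_{n=1}^∞ G_j(Ω, u_{k+1})[V_jG_j(Ω, u_{k+1})]ⁿ. […] We insert the expansion for V_j into this formula […]. Terms
whose order in e_j (or equivalently in Ã̃) is between 1 and n̄ are considered as part of −W^{(j,n̄)}. Terms of higher order, or
involving F_{2,j}(X) or V_j(X) are grouped into an expansion Σ_X −W^{(j)}(X), with |W^{(j)}(X; x₁, x₂)| ≦ e_j^{n̄+1−α}e^{−cr(e_k)|X|⁻}.
Thus we have written the interaction term in (5.7.2) as W^{(j)} = W^{(j,n̄)} + Σ_X W^{(j)}(X)."* — the insertion of the expansion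
(5.7.7) of `V_j` into the NEUMANN SERIES, term by term and summed, with the order bookkeeping and the kernel bound (file 3
of seat p13 gen 9; files 1a/1b `BIJ88F1Localized290`/`BIJ88F2Localized290`, 2a/2b `BIJ88Expansion577`/`…Bounds`).

statement-level skeleton of published theorems with citation tags; proofs where landed; nothing here is a claim about the Yang–Mills mass gap

PDF held: `paper:balaban1988-cmp114-bij-abelian-higgs-effective-action` (journal page = PDF page + 256); pp. 287–291
[PDF 31–35] read as IMAGES (CCITT renders; copies `HOME/lit-balaban-p13/pages/`).

CITATION HEADER (lean-in-tree rule).  Part of the lit-balaban TYPED SKELETON (HOME `run/shared/lean/pub/lit-balaban/`):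
WHAT IS REPRODUCED = row **C2.Eq5.7.7-5.7.9** of `HOME/lit-balaban-r16/ROWS-C2-part2.md`, member (5.7.7), the `W^{(j)}` display
*"W^{(j)} = W^{(j,n̄)} + Σ_X W^{(j)}(X)"* with its kernel bound (status before: absent / DEF-level).  Unit `lit-balaban-p13` (gen 9),
owner r16, referee ref-5.  Built BY NAME on 2a/2b (`GLExp`, `val`, `mul`, `lsum`, `smul`, `one`, `Rooted`, `Conn`, `lowNormW`,
`actNorm`, `size_mul_le`-type bounds), gen 8's `cubePolymers`, r16's `PolymerSys.cardMinus`; nothing restated.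

## The typing (model level, READING declared)

Sites `T` of the cube `□(x₁,x₂)` (finite); `G : T → T → ℂ` the entries of `G_j(□(x₁,x₂), u_{k+1})` (order-0 coefficients);
`V y y′ : GLExp ι` the expansion (5.7.7) of the entry `V_j(y,y′)` (file 2a), of positive order (`low 0 = 0`: every term of `V_j`
carries a factor `e_j`), rooted at the home cube `c₀` and connected — the regions of `W^{(j)}` are unions of the coarser
`L^{k−j}r(e_k)`-cubes (p. 294 *"As always, X is a connected union of L^{k−j}r(e_k)-cubes"*), one of which carries `□(x₁,x₂)`.
The `n`-th Neumann term `G[V_jG]ⁿ` with (5.7.7) inserted is the expansion `neumannExp n x₁ x₂` (iterated `lsum`/`mul` of 2a);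
their series from `n = 1` is `wExp x₁ x₂`; `W^{(j,n̄)}`-part := its orders `1 … n̄` (`lowVal`), `W^{(j)}(X; x₁, x₂)` := its part
localized in `X` (`act X`).  Sizes: `lowNormW ρ` (weight `|e_j| ≤ ρ ≤ 1`) and `actNorm κ` of 2b; inputs `‖G(x,y)‖ ≤ γ`,
`Σ_y ‖G(x,y)‖ ≤ g`, `Σ_{y′} lowNormW(V y y′) ≤ ℓ`, `Σ_{y′} actNorm(V y y′) ≤ a`, and `θ = g(ℓ + a) < 1` (*"the operator after the
identity is bounded by a very small number"*, p. 289).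

## What is kernel-checked here

* §1 order bookkeeping: `OrderGe` (*"order in e_j"*), `orderGe_mul` (orders add under products), `orderGe_lsum`.
* §2 `neumannExp`, **`val_neumannExp`** (`= (G(V̂G)ⁿ)(x₁,x₂)`, `V̂` = the matrix of represented entries), `neumannExp_rooted`,
  `neumannExp_conn`, **`neumannExp_orderGe`** (the `n`-th term has order `≥ n` in `e_j`), `neumannExp_low_eq_zero_of_lt`.
* §3 sizes by induction: **`lowNormW_neumannExp_le`** (`≤ γθⁿ`), **`actNorm_neumannExp_le`** (`≤ n·γg(qℓ + a)·θ^{n−1}`,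
  `q = (|e_j|/ρ)^{n̄+1}`: the localized part of every term carries ONE small factor — an overflow `q·ℓ` or a `V_j(X)`-size `a`).
* §4 the series (hypotheses bundled in `Hyps`): `summable_low`/`summable_act`, `hasSum_majorant`, `wExp`, **`val_wExp`** (`Σ_{n≥1} (G(V̂G)ⁿ)(x₁,x₂) = lowVal (wExp) + Σ_X act X
  (wExp)` — *"W^{(j)} = W^{(j,n̄)} + Σ_X W^{(j)}(X)"* for the propagator series), **`wExp_low_zero`** (*"order … between 1 and n̄"*),
  `wExp_low_eq_sum` (only the terms `n ≤ m` contribute to order `m`), `wExp_rooted`, `wExp_conn`, **`norm_wExp_act_le`**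
  (`‖W(X; x₁, x₂)‖ ≤ γg(qℓ + a)/(1−θ)²·e^{−κ|X|⁻}`) and the PRINTED SHAPE **`norm_wExp_act_le_printed`**
  (`≤ e_j^{n̄+1−α′}e^{−κ|X|⁻}` under the displayed constants inequality `γg(qℓ + a)/(1−θ)² ≤ e_j^{n̄+1−α′}`, generic-constant reading);
  **`w_split`** = the identity + order + rootedness assembled.

HONEST SCOPE.  Model level: the propagator entries, the entry expansions of `V_j` and their sizes are INPUTS (2a/2b and 1a/1b
supply the shapes); the assembly of `W^{(j)}` from `Δ_{j,loc} + aL^{−2}P` with the expansions of `Q_j`, `Q`, `G_{j,loc}` and the kernel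
`ζ″_j` inserted is finite bookkeeping by 2a's `lsum`/`mul` and is not spelled out; the resolvent identity behind the Neumann
series ((5.6.11), p36's `BIJ88Resolvent5711`) is not re-derived — the series `Σ_{n≥1} G(V̂G)ⁿ` is the object.  Definitions with
bodies (`OrderGe`, `neumannExp`, `wExp`) + theorems; no `Prop` facts; axioms standard.
-/

noncomputable section

open scoped BigOperators
open Finset

namespace Literature.MathematicalPhysics.QuantumFieldTheory.BalabanImbrieJaffe1984to88.BIJ88WSplit290

open BIJ88TraceTerms579 (cubePolymers)
open BIJ88Sect5StatementsPart2 (PolymerSys)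
open BIJ88Expansion577 BIJ88Expansion577.GLExp BIJ88Expansion577Bounds

variable {ι : Type}

/-! ## §1 Order bookkeeping: *"order in e_j"* -/

/-- `E` has order `≥ a` in `e_j`: its coefficients of `e_j^m`, `m < a`, vanish (*"Each term in W^{(j)} has at least one factor
e_j"*, p. 289; *"Terms whose order in e_j … is between 1 and n̄"*, p. 290). [cite: BalabanImbrieJaffe1988, (5.7.7) p.290] -/
def OrderGe (a : ℕ) (E : GLExp ι) : Prop := ∀ m, m < a → E.low m = 0

/-- **orders add under products** (the truncated product of 2a). [cite: BalabanImbrieJaffe1988, (5.7.7) p.290] -/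
theorem orderGe_mul [Fintype ι] [DecidableEq ι] (nbar : ℕ) (ε : ℝ) (c₀ : ι) {a b : ℕ} {E F : GLExp ι} (hE : OrderGe a E)
    (hF : OrderGe b F) : OrderGe (a + b) (mul nbar ε c₀ E F) := by
  intro m hm
  show (if m ≤ nbar then conv nbar E F m else 0) = 0
  split_ifs with h
  · unfold conv
    refine Finset.sum_eq_zero fun i _ => Finset.sum_eq_zero fun j _ => ?_
    split_ifs with hij
    · rcases lt_or_ge i a with hi | hi
      · rw [hE i hi, zero_mul]
      · have hj : j < b := by omega
        rw [hF j hj, mul_zero]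
    · rfl
  · rfl

/-- [cite: BalabanImbrieJaffe1988, (5.7.7) p.290] -/
theorem orderGe_lsum {K : Type*} {a : ℕ} (s : Finset K) (c : K → ℂ) {E : K → GLExp ι} (hE : ∀ k ∈ s, OrderGe a (E k)) :
    OrderGe a (lsum s c E) := fun m hm =>
  Finset.sum_eq_zero fun k hk => by rw [hE k hk m hm, mul_zero]

/-- [cite: BalabanImbrieJaffe1988, (5.7.7) p.290] -/
theorem orderGe_zero (E : GLExp ι) : OrderGe 0 E := fun _ hm => absurd hm (Nat.not_lt_zero _)

/-- sizes of a multiple: `lowNormW ρ (c • E) = ‖c‖·lowNormW ρ E`. [cite: BalabanImbrieJaffe1988, (5.7.7) p.290] -/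
theorem lowNormW_smul (ρ : ℝ) (nbar : ℕ) (c : ℂ) (E : GLExp ι) : lowNormW ρ nbar (smul c E) = ‖c‖ * lowNormW ρ nbar E := by
  unfold lowNormW smul
  rw [Finset.mul_sum]
  exact Finset.sum_congr rfl fun n _ => by simp only [norm_mul]; ring

/-- `actNorm κ (c • E) = ‖c‖·actNorm κ E`. [cite: BalabanImbrieJaffe1988, (5.7.7) p.290] -/
theorem actNorm_smul [Fintype ι] (κ : ℝ) (c : ℂ) (E : GLExp ι) : (smul c E).actNorm κ = ‖c‖ * E.actNorm κ := by
  unfold actNorm smul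
  rw [Finset.mul_sum]
  exact Finset.sum_congr rfl fun X _ => by simp only [norm_mul, mul_assoc]

/-! ## §2 The Neumann terms `G[V_jG]ⁿ` with the expansion of `V_j` inserted -/

section Neumann

variable [Fintype ι] [DecidableEq ι] {T : Type*} [Fintype T]
  (nbar : ℕ) (ε : ℝ) (c₀ : ι) (G : T → T → ℂ) (V : T → T → GLExp ι)

/-- **the expansion of the `n`-th Neumann term** `(G_j[V_jG_j]ⁿ)(x₁,x₂)` obtained by *"insert[ing] the expansion for V_j into
this formula"*: `n = 0`: the coefficient `G(x₁,x₂)` times `1`; `n+1`: `Σ_{y,y′} G(x₁,y)·(V(y,y′)·[n-th term](y′,x₂))` (2a's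
`lsum`, `mul`). [cite: BalabanImbrieJaffe1988, (5.7.7) p.290] -/
def neumannExp : ℕ → T → T → GLExp ι
  | 0, x₁, x₂ => smul (G x₁ x₂) one
  | n + 1, x₁, x₂ => lsum (univ ×ˢ univ) (fun p : T × T => G x₁ p.1) fun p => mul nbar ε c₀ (V p.1 p.2) (neumannExp n p.2 x₂)

/-- the Neumann-term expansions are rooted at the home cube. [cite: BalabanImbrieJaffe1988, (5.7.7) p.290] -/
theorem neumannExp_rooted (hV : ∀ y y', Rooted c₀ (V y y')) :
    ∀ (n : ℕ) (x₁ x₂ : T), Rooted c₀ (neumannExp nbar ε c₀ G V n x₁ x₂)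
  | 0, x₁, x₂ => fun X hX => by simp [neumannExp, smul, one] at hX
  | n + 1, x₁, x₂ => Rooted.lsum c₀ fun p _ => Rooted.mul nbar ε c₀ (hV p.1 p.2) (neumannExp_rooted hV n p.2 x₂)

/-- … and their regions are connected unions of cubes. [cite: BalabanImbrieJaffe1988, (5.7.7) p.290] -/
theorem neumannExp_conn {R : ι → ι → Prop} (hV : ∀ y y', Rooted c₀ (V y y')) (hVc : ∀ y y', Conn R (V y y')) :
    ∀ (n : ℕ) (x₁ x₂ : T), Conn R (neumannExp nbar ε c₀ G V n x₁ x₂)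
  | 0, x₁, x₂ => fun X hX => by simp [neumannExp, smul, one] at hX
  | n + 1, x₁, x₂ => Conn.lsum fun p _ =>
      Conn.mul nbar ε c₀ (hV p.1 p.2) (neumannExp_rooted nbar ε c₀ G V hV n p.2 x₂) (hVc p.1 p.2)
        (neumannExp_conn hV hVc n p.2 x₂)

/-- **THE `n`-TH TERM HAS ORDER `≥ n` IN `e_j`** (every factor `V_j` carries an `e_j`: `low 0 = 0`).
[cite: BalabanImbrieJaffe1988, (5.7.7) p.290] -/
theorem neumannExp_orderGe (hV : ∀ y y', (V y y').low 0 = 0) :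
    ∀ (n : ℕ) (x₁ x₂ : T), OrderGe n (neumannExp nbar ε c₀ G V n x₁ x₂)
  | 0, x₁, x₂ => orderGe_zero _
  | n + 1, x₁, x₂ => by
      rw [neumannExp, show n + 1 = 1 + n by ring]
      refine orderGe_lsum _ _ fun p _ => orderGe_mul nbar ε c₀ (fun m hm => ?_) (neumannExp_orderGe hV n p.2 x₂)
      obtain rfl : m = 0 := by omega
      exact hV p.1 p.2

/-- beyond the window there are no coefficients: `low m = 0` for `m > n̄`. [cite: BalabanImbrieJaffe1988, (5.7.7) p.290] -/
theorem neumannExp_low_eq_zero_of_lt {m : ℕ} (hm : nbar < m) :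
    ∀ (n : ℕ) (x₁ x₂ : T), (neumannExp nbar ε c₀ G V n x₁ x₂).low m = 0
  | 0, x₁, x₂ => by
      have : m ≠ 0 := by omega
      simp [neumannExp, smul, one, this]
  | n + 1, x₁, x₂ => Finset.sum_eq_zero fun p _ => by
      show G x₁ p.1 * (if m ≤ nbar then conv nbar (V p.1 p.2) _ m else 0) = 0
      rw [if_neg (not_le.mpr hm), mul_zero]

/-! ## §3 The sizes of the Neumann terms -/

variable {ρ κ γ g ℓ a : ℝ}

/-- **size of the order-`≤ n̄` parts**: `lowNormW ρ (n-th term) ≤ γ·θⁿ` for any `θ ≥ gℓ`, from `‖G(x,y)‖ ≤ γ`, `Σ_y‖G(x,y)‖ ≤ g`,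
`Σ_{y′} lowNormW ρ (V y y′) ≤ ℓ`. [cite: BalabanImbrieJaffe1988, (5.7.7) p.290] -/
theorem lowNormW_neumannExp_le (hρ : 0 ≤ ρ) (hγ : ∀ x y, ‖G x y‖ ≤ γ) (hg : ∀ x, ∑ y, ‖G x y‖ ≤ g)
    (hℓ : ∀ y, ∑ y', lowNormW ρ nbar (V y y') ≤ ℓ) {θ : ℝ} (hθ : g * ℓ ≤ θ) (hθ0 : 0 ≤ θ) :
    ∀ (n : ℕ) (x₁ x₂ : T), lowNormW ρ nbar (neumannExp nbar ε c₀ G V n x₁ x₂) ≤ γ * θ ^ n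
  | 0, x₁, x₂ => by
      rw [neumannExp, lowNormW_smul, lowNormW_one, mul_one, pow_zero, mul_one]
      exact hγ x₁ x₂
  | n + 1, x₁, x₂ => by
      have hγ0 : 0 ≤ γ := (norm_nonneg _).trans (hγ x₁ x₂)
      have hℓ0 : 0 ≤ ℓ := (Finset.sum_nonneg fun _ _ => lowNormW_nonneg nbar hρ _).trans (hℓ x₁)
      have IH := fun y' => lowNormW_neumannExp_le hρ hγ hg hℓ hθ hθ0 n y' x₂
      rw [neumannExp]
      refine (lowNormW_lsum_le nbar hρ _ _ _).trans ?_
      calc ∑ p ∈ univ ×ˢ univ, ‖G x₁ p.1‖ * lowNormW ρ nbar (mul nbar ε c₀ (V p.1 p.2) (neumannExp nbar ε c₀ G V n p.2 x₂))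
          ≤ ∑ p ∈ univ ×ˢ univ, ‖G x₁ p.1‖ * (lowNormW ρ nbar (V p.1 p.2) * (γ * θ ^ n)) :=
            Finset.sum_le_sum fun p _ => mul_le_mul_of_nonneg_left ((lowNormW_mul_le nbar hρ ε c₀ _ _).trans
              (mul_le_mul_of_nonneg_left (IH p.2) (lowNormW_nonneg nbar hρ _))) (norm_nonneg _)
        _ = ∑ y, ‖G x₁ y‖ * ((∑ y', lowNormW ρ nbar (V y y')) * (γ * θ ^ n)) := by
            rw [Finset.sum_product]
            refine Finset.sum_congr rfl fun y _ => ?_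
            dsimp only
            rw [← Finset.mul_sum, Finset.sum_mul]
        _ ≤ ∑ y, ‖G x₁ y‖ * (ℓ * (γ * θ ^ n)) :=
            Finset.sum_le_sum fun y _ => mul_le_mul_of_nonneg_left
              (mul_le_mul_of_nonneg_right (hℓ y) (by positivity)) (norm_nonneg _)
        _ = (∑ y, ‖G x₁ y‖) * (ℓ * (γ * θ ^ n)) := by rw [Finset.sum_mul]
        _ ≤ g * (ℓ * (γ * θ ^ n)) := mul_le_mul_of_nonneg_right (hg x₁) (by positivity)
        _ = γ * ((g * ℓ) * θ ^ n) := by ring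
        _ ≤ γ * (θ * θ ^ n) := mul_le_mul_of_nonneg_left (mul_le_mul_of_nonneg_right hθ (pow_nonneg hθ0 _)) hγ0
        _ = γ * θ ^ (n + 1) := by rw [pow_succ']

/-- arithmetic of the induction: `θ·(n·c·θ^{n−1}) = n·c·θⁿ` (also for `n = 0`). [folklore] -/
private theorem mul_step (θ c : ℝ) (n : ℕ) : θ * (n * c * θ ^ (n - 1)) = n * c * θ ^ n := by
  rcases Nat.eq_zero_or_pos n with rfl | hn
  · simp
  · rw [show θ ^ n = θ ^ (n - 1) * θ by rw [← pow_succ, Nat.sub_add_cancel hn]]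
    ring

/-- **SIZE OF THE LOCALIZED PARTS** (rooted `V`, `0 < ρ`, `|e_j| ≤ ρ`, `κ ≥ 0`): with `q = (|e_j|/ρ)^{n̄+1}`, `Σ_{y′} actNorm κ (V y y′) ≤ a`
and `θ = g(ℓ + a)`: `actNorm κ (n-th term) ≤ n·γ·g(qℓ + a)·θ^{n−1}` — each term's localized part has exactly one "first" small
factor (an overflow `qℓ` or a `V_j(X)`-size `a`), the rest is bounded by sizes. [cite: BalabanImbrieJaffe1988, (5.7.7) p.290] -/
theorem actNorm_neumannExp_le (hρ : 0 < ρ) (hερ : |ε| ≤ ρ) (hκ : 0 ≤ κ) (hV : ∀ y y', Rooted c₀ (V y y'))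
    (hγ : ∀ x y, ‖G x y‖ ≤ γ) (hg : ∀ x, ∑ y, ‖G x y‖ ≤ g)
    (hℓ : ∀ y, ∑ y', lowNormW ρ nbar (V y y') ≤ ℓ) (ha : ∀ y, ∑ y', (V y y').actNorm κ ≤ a) :
    ∀ (n : ℕ) (x₁ x₂ : T), (neumannExp nbar ε c₀ G V n x₁ x₂).actNorm κ ≤
      n * (γ * (g * ((|ε| / ρ) ^ (nbar + 1) * ℓ + a))) * (g * (ℓ + a)) ^ (n - 1)
  | 0, x₁, x₂ => by
      rw [neumannExp, actNorm_smul, actNorm_one, mul_zero, Nat.cast_zero, zero_mul, zero_mul]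
  | n + 1, x₁, x₂ => by
      set q : ℝ := (|ε| / ρ) ^ (nbar + 1) with hq
      set θ : ℝ := g * (ℓ + a) with hθ
      have hq0 : 0 ≤ q := pow_nonneg (div_nonneg (abs_nonneg _) hρ.le) _
      have hγ0 : 0 ≤ γ := (norm_nonneg _).trans (hγ x₁ x₂)
      have hg0 : 0 ≤ g := (Finset.sum_nonneg fun _ _ => norm_nonneg _).trans (hg x₁)
      have hℓ0 : 0 ≤ ℓ := (Finset.sum_nonneg fun _ _ => lowNormW_nonneg nbar hρ.le _).trans (hℓ x₁)
      have ha0 : 0 ≤ a := (Finset.sum_nonneg fun _ _ => actNorm_nonneg κ _).trans (ha x₁)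
      have hθ0 : 0 ≤ θ := mul_nonneg hg0 (add_nonneg hℓ0 ha0)
      have hgl : g * ℓ ≤ θ := by rw [hθ]; nlinarith
      -- the bounds of the previous term
      set Λ : ℝ := γ * θ ^ n with hΛ
      set A : ℝ := n * (γ * (g * (q * ℓ + a))) * θ ^ (n - 1) with hA
      have hΛn : ∀ y', lowNormW ρ nbar (neumannExp nbar ε c₀ G V n y' x₂) ≤ Λ := fun y' =>
        lowNormW_neumannExp_le nbar ε c₀ G V hρ.le hγ hg hℓ hgl hθ0 n y' x₂
      have hAn : ∀ y', (neumannExp nbar ε c₀ G V n y' x₂).actNorm κ ≤ A := fun y' =>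
        actNorm_neumannExp_le hρ hερ hκ hV hγ hg hℓ ha n y' x₂
      have hΛ0 : 0 ≤ Λ := mul_nonneg hγ0 (pow_nonneg hθ0 _)
      have hA0 : 0 ≤ A := by rw [hA]; positivity
      rw [neumannExp]
      refine (actNorm_lsum_le κ _ _ _).trans ?_
      -- per pair (y, y′): the product bound of 2b
      have hpair : ∀ p : T × T, (mul nbar ε c₀ (V p.1 p.2) (neumannExp nbar ε c₀ G V n p.2 x₂)).actNorm κ ≤
          lowNormW ρ nbar (V p.1 p.2) * (q * Λ + A) + (V p.1 p.2).actNorm κ * (Λ + A) := by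
        intro p
        refine (actNorm_mul_le nbar κ c₀ hρ hερ hκ (hV p.1 p.2) (neumannExp_rooted nbar ε c₀ G V hV n p.2 x₂)).trans ?_
        have h1 := lowNormW_nonneg nbar hρ.le (V p.1 p.2)
        have h2 := actNorm_nonneg κ (V p.1 p.2)
        have h3 := hΛn p.2
        have h4 := hAn p.2
        have h5 := lowNormW_nonneg nbar hρ.le (neumannExp nbar ε c₀ G V n p.2 x₂)
        have h6 := actNorm_nonneg κ (neumannExp nbar ε c₀ G V n p.2 x₂)
        rw [← hq]
        nlinarith [mul_le_mul_of_nonneg_left h3 (mul_nonneg hq0 h1), mul_le_mul_of_nonneg_left h4 h1,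
          mul_le_mul_of_nonneg_left h3 h2, mul_le_mul_of_nonneg_left h4 h2]
      calc ∑ p ∈ univ ×ˢ univ, ‖G x₁ p.1‖ * (mul nbar ε c₀ (V p.1 p.2) (neumannExp nbar ε c₀ G V n p.2 x₂)).actNorm κ
          ≤ ∑ p ∈ univ ×ˢ univ, ‖G x₁ p.1‖ *
              (lowNormW ρ nbar (V p.1 p.2) * (q * Λ + A) + (V p.1 p.2).actNorm κ * (Λ + A)) :=
            Finset.sum_le_sum fun p _ => mul_le_mul_of_nonneg_left (hpair p) (norm_nonneg _)
        _ = ∑ y, ‖G x₁ y‖ * ((∑ y', lowNormW ρ nbar (V y y')) * (q * Λ + A) + (∑ y', (V y y').actNorm κ) * (Λ + A)) := by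
            rw [Finset.sum_product]
            refine Finset.sum_congr rfl fun y _ => ?_
            dsimp only
            rw [← Finset.mul_sum, Finset.sum_add_distrib, Finset.sum_mul, Finset.sum_mul]
        _ ≤ ∑ y, ‖G x₁ y‖ * (ℓ * (q * Λ + A) + a * (Λ + A)) :=
            Finset.sum_le_sum fun y _ => mul_le_mul_of_nonneg_left (add_le_add
              (mul_le_mul_of_nonneg_right (hℓ y) (by positivity)) (mul_le_mul_of_nonneg_right (ha y) (by positivity)))
              (norm_nonneg _)
        _ = (∑ y, ‖G x₁ y‖) * (ℓ * (q * Λ + A) + a * (Λ + A)) := by rw [Finset.sum_mul]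
        _ ≤ g * (ℓ * (q * Λ + A) + a * (Λ + A)) := mul_le_mul_of_nonneg_right (hg x₁) (by positivity)
        _ = γ * (g * (q * ℓ + a)) * θ ^ n + θ * A := by rw [hΛ, hθ]; ring
        _ = ((n + 1 : ℕ) : ℝ) * (γ * (g * (q * ℓ + a))) * θ ^ (n + 1 - 1) := by
            rw [hA, mul_step θ (γ * (g * (q * ℓ + a))) n, Nat.add_sub_cancel]
            push_cast
            ring

section Val

variable [DecidableEq T]

/-- the matrix of the represented entries `V̂(y,y′) = val (V y y′)` (= `V_j(y,y′)` by (5.7.7)) and of `G`.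
[cite: BalabanImbrieJaffe1988, (5.7.7) p.290] -/
def valMatrix : Matrix T T ℂ := Matrix.of fun y y' => (V y y').val nbar ε

/-- **`val (neumannExp n x₁ x₂) = (G(V̂G)ⁿ)(x₁,x₂)`** — the inserted expansion represents the `n`-th Neumann term (2a's
`val_lsum`, `val_mul`). [cite: BalabanImbrieJaffe1988, (5.7.7) p.290] -/
theorem val_neumannExp : ∀ (n : ℕ) (x₁ x₂ : T),
    (neumannExp nbar ε c₀ G V n x₁ x₂).val nbar ε = (Matrix.of G * (valMatrix nbar ε V * Matrix.of G) ^ n) x₁ x₂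
  | 0, x₁, x₂ => by simp [neumannExp, val_smul, val_one]
  | n + 1, x₁, x₂ => by
      rw [neumannExp, val_lsum, pow_succ', ← mul_assoc, Matrix.mul_assoc (Matrix.of G), Matrix.mul_apply,
        Finset.sum_product]
      refine Finset.sum_congr rfl fun y _ => ?_
      rw [Matrix.mul_assoc, Matrix.mul_apply, Finset.mul_sum]
      refine Finset.sum_congr rfl fun y' _ => ?_
      rw [val_mul, val_neumannExp n y' x₂]
      rfl

end Val

end Neumann

/-! ## §4 The series `Σ_{n≥1} G[V_jG]ⁿ` and the split `W^{(j)} = W^{(j,n̄)} + Σ_X W^{(j)}(X)` -/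

section Series

variable [Fintype ι] [DecidableEq ι] {T : Type*} [Fintype T] [Nonempty T]
  (nbar : ℕ) (ε : ℝ) (c₀ : ι) (G : T → T → ℂ) (V : T → T → GLExp ι) {ρ κ γ g ℓ a : ℝ}

/-- **the expansion of the propagator series** `Σ_{n≥1} (G_j[V_jG_j]ⁿ)(x₁,x₂)` (termwise sums of the Neumann-term expansions):
its orders `1 … n̄` are the `W^{(j,n̄)}`-part, its part localized in `X` is `W^{(j)}(X; x₁, x₂)` (for this piece of (5.7.2)).
[cite: BalabanImbrieJaffe1988, (5.7.7) p.290] -/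
def wExp (x₁ x₂ : T) : GLExp ι :=
  ⟨fun m => ∑' n : ℕ, (neumannExp nbar ε c₀ G V (n + 1) x₁ x₂).low m,
   fun X => ∑' n : ℕ, (neumannExp nbar ε c₀ G V (n + 1) x₁ x₂).act X⟩

/-- the hypotheses of §4, bundled: weight `0 < ρ`, `|e_j| ≤ ρ`; rate `κ ≥ 0`; `V_j` rooted, of positive order; the four size inputs
`‖G(x,y)‖ ≤ γ`, `Σ_y ‖G(x,y)‖ ≤ g`, `Σ_{y′} lowNormW ρ (V y y′) ≤ ℓ`, `Σ_{y′} actNorm κ (V y y′) ≤ a`; and the convergence condition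
`θ = g(ℓ + a) < 1` (*"the operator after the identity is bounded by a very small number"*). [cite: BalabanImbrieJaffe1988, (5.7.7) p.290] -/
structure Hyps (nbar : ℕ) (ε : ℝ) (c₀ : ι) (G : T → T → ℂ) (V : T → T → GLExp ι) (ρ κ γ g ℓ a : ℝ) : Prop where
  hρ : 0 < ρ
  hερ : |ε| ≤ ρ
  hκ : 0 ≤ κ
  rooted : ∀ y y', Rooted c₀ (V y y')
  posOrder : ∀ y y', (V y y').low 0 = 0
  hγ : ∀ x y, ‖G x y‖ ≤ γ
  hg : ∀ x, ∑ y, ‖G x y‖ ≤ g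
  hℓ : ∀ y, ∑ y', lowNormW ρ nbar (V y y') ≤ ℓ
  ha : ∀ y, ∑ y', (V y y').actNorm κ ≤ a
  hθ : g * (ℓ + a) < 1

variable {nbar ε c₀ G V}

namespace Hyps

variable (H : Hyps nbar ε c₀ G V ρ κ γ g ℓ a)
include H

omit [DecidableEq ι] in
/-- [cite: BalabanImbrieJaffe1988, (5.7.7) p.290] -/
theorem γ_nonneg : 0 ≤ γ := (norm_nonneg _).trans (H.hγ (Classical.arbitrary T) (Classical.arbitrary T))

omit [DecidableEq ι] in
/-- [cite: BalabanImbrieJaffe1988, (5.7.7) p.290] -/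
theorem g_nonneg : 0 ≤ g := (Finset.sum_nonneg fun _ _ => norm_nonneg _).trans (H.hg (Classical.arbitrary T))

omit [DecidableEq ι] in
/-- [cite: BalabanImbrieJaffe1988, (5.7.7) p.290] -/
theorem ℓ_nonneg : 0 ≤ ℓ :=
  (Finset.sum_nonneg fun _ _ => lowNormW_nonneg nbar H.hρ.le _).trans (H.hℓ (Classical.arbitrary T))

omit [DecidableEq ι] in
/-- [cite: BalabanImbrieJaffe1988, (5.7.7) p.290] -/
theorem a_nonneg : 0 ≤ a := (Finset.sum_nonneg fun _ _ => actNorm_nonneg κ _).trans (H.ha (Classical.arbitrary T))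

omit [DecidableEq ι] in
/-- [cite: BalabanImbrieJaffe1988, (5.7.7) p.290] -/
theorem θ_nonneg : 0 ≤ g * (ℓ + a) := mul_nonneg H.g_nonneg (add_nonneg H.ℓ_nonneg H.a_nonneg)

/-- [cite: BalabanImbrieJaffe1988, (5.7.7) p.290] -/
theorem lowNormW_term_le (n : ℕ) (x₁ x₂ : T) :
    lowNormW ρ nbar (neumannExp nbar ε c₀ G V n x₁ x₂) ≤ γ * (g * (ℓ + a)) ^ n :=
  lowNormW_neumannExp_le nbar ε c₀ G V H.hρ.le H.hγ H.hg H.hℓ (by nlinarith [H.g_nonneg, H.a_nonneg]) H.θ_nonneg n x₁ x₂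

omit [Nonempty T] in
/-- [cite: BalabanImbrieJaffe1988, (5.7.7) p.290] -/
theorem actNorm_term_le (n : ℕ) (x₁ x₂ : T) :
    (neumannExp nbar ε c₀ G V n x₁ x₂).actNorm κ ≤
      n * (γ * (g * ((|ε| / ρ) ^ (nbar + 1) * ℓ + a))) * (g * (ℓ + a)) ^ (n - 1) :=
  actNorm_neumannExp_le nbar ε c₀ G V H.hρ H.hερ H.hκ H.rooted H.hγ H.hg H.hℓ H.ha n x₁ x₂

omit [DecidableEq ι] [Nonempty T] in
/-- a single coefficient is controlled by the weighted size: `ρ^m‖low m‖ ≤ lowNormW ρ` (`m ≤ n̄`).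
[cite: BalabanImbrieJaffe1988, (5.7.7) p.290] -/
theorem pow_mul_norm_low_le {m : ℕ} (hm : m ≤ nbar) (E : GLExp ι) : ρ ^ m * ‖E.low m‖ ≤ lowNormW ρ nbar E :=
  Finset.single_le_sum (f := fun n => ρ ^ n * ‖E.low n‖) (fun _ _ => mul_nonneg (pow_nonneg H.hρ.le _) (norm_nonneg _))
    (Finset.mem_range.mpr (Nat.lt_succ_of_le hm))

/-- the coefficient series converge (geometric majorant `ρ^{−m}γθ^{n+1}`). [cite: BalabanImbrieJaffe1988, (5.7.7) p.290] -/
theorem summable_low (x₁ x₂ : T) (m : ℕ) : Summable fun n : ℕ => (neumannExp nbar ε c₀ G V (n + 1) x₁ x₂).low m := by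
  rcases le_or_gt m nbar with hm | hm
  · refine Summable.of_norm_bounded (g := fun n : ℕ => (ρ ^ m)⁻¹ * (γ * (g * (ℓ + a)) ^ (n + 1))) ?_ fun n => ?_
    · refine Summable.mul_left _ (Summable.mul_left _ ?_)
      exact (summable_nat_add_iff 1).mpr (summable_geometric_of_lt_one H.θ_nonneg H.hθ)
    · have hρm : 0 < ρ ^ m := pow_pos H.hρ _
      rw [le_inv_mul_iff₀ hρm]
      exact (H.pow_mul_norm_low_le hm _).trans (H.lowNormW_term_le (n + 1) x₁ x₂)
  · refine summable_zero.congr fun n => ?_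
    exact (neumannExp_low_eq_zero_of_lt nbar ε c₀ G V hm (n + 1) x₁ x₂).symm

omit [DecidableEq ι] in
/-- the majorant `(n+1)θⁿ` is summable with sum `1/(1−θ)²`. [cite: BalabanImbrieJaffe1988, (5.7.7) p.290] -/
theorem hasSum_majorant : HasSum (fun n : ℕ => ((n : ℝ) + 1) * (g * (ℓ + a)) ^ n) (1 / (1 - g * (ℓ + a)) ^ 2) := by
  have hθ1 : ‖g * (ℓ + a)‖ < 1 := by rw [Real.norm_eq_abs, abs_of_nonneg H.θ_nonneg]; exact H.hθ
  have h1 := hasSum_coe_mul_geometric_of_norm_lt_one hθ1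
  have h0 := hasSum_geometric_of_lt_one H.θ_nonneg H.hθ
  have hne : (1 - g * (ℓ + a)) ≠ 0 := by have := H.hθ; intro h; linarith
  have hf : (fun n : ℕ => ((n : ℝ) + 1) * (g * (ℓ + a)) ^ n) = fun n : ℕ => (n : ℝ) * (g * (ℓ + a)) ^ n + (g * (ℓ + a)) ^ n := by
    funext n; ring
  have hval : 1 / (1 - g * (ℓ + a)) ^ 2 = g * (ℓ + a) / (1 - g * (ℓ + a)) ^ 2 + (1 - g * (ℓ + a))⁻¹ := by
    field_simp
    ring
  rw [hf, hval]
  exact h1.add h0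

omit [Nonempty T] in
/-- the localized series converge: `‖act X (n+1-st term)‖ ≤ (n+1)·C·θⁿ·e^{−κ|X|⁻}`, `C = γg(qℓ + a)`.
[cite: BalabanImbrieJaffe1988, (5.7.7) p.290] -/
theorem norm_act_term_le (x₁ x₂ : T) (X : Finset ι) (n : ℕ) :
    ‖(neumannExp nbar ε c₀ G V (n + 1) x₁ x₂).act X‖ ≤
      ((n : ℝ) + 1) * (g * (ℓ + a)) ^ n * (γ * (g * ((|ε| / ρ) ^ (nbar + 1) * ℓ + a))) *
        Real.exp (-κ * (cubePolymers ι).cardMinus X) := by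
  refine (norm_act_le_actNorm κ _ X).trans (mul_le_mul_of_nonneg_right ?_ (Real.exp_pos _).le)
  refine (H.actNorm_term_le (n + 1) x₁ x₂).trans (le_of_eq ?_)
  rw [Nat.add_sub_cancel]; push_cast; ring

/-- [cite: BalabanImbrieJaffe1988, (5.7.7) p.290] -/
theorem summable_act (x₁ x₂ : T) (X : Finset ι) :
    Summable fun n : ℕ => (neumannExp nbar ε c₀ G V (n + 1) x₁ x₂).act X :=
  Summable.of_norm_bounded ((H.hasSum_majorant.summable.mul_right _).mul_right _) (H.norm_act_term_le x₁ x₂ X)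

omit [Nonempty T] in
/-- **"TERMS WHOSE ORDER IN e_j … IS BETWEEN 1 AND n̄"**: the order-`≤ n̄` part of the series has no order-0 term.
[cite: BalabanImbrieJaffe1988, (5.7.7) p.290] -/
theorem wExp_low_zero (x₁ x₂ : T) : (wExp nbar ε c₀ G V x₁ x₂).low 0 = 0 := by
  show ∑' n : ℕ, (neumannExp nbar ε c₀ G V (n + 1) x₁ x₂).low 0 = 0
  rw [tsum_congr fun n => neumannExp_orderGe nbar ε c₀ G V H.posOrder (n + 1) x₁ x₂ 0 (Nat.succ_pos n), tsum_zero]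

omit [Nonempty T] in
/-- only the terms `G(V̂G)ⁿ`, `n ≤ m`, contribute to the order `m` (the `n`-th term has order `≥ n`): the coefficient of `e_j^m`
is a FINITE sum. [cite: BalabanImbrieJaffe1988, (5.7.7) p.290, (5.7.9) p.291] -/
theorem wExp_low_eq_sum (x₁ x₂ : T) (m : ℕ) :
    (wExp nbar ε c₀ G V x₁ x₂).low m = ∑ n ∈ range m, (neumannExp nbar ε c₀ G V (n + 1) x₁ x₂).low m := by
  show ∑' n : ℕ, (neumannExp nbar ε c₀ G V (n + 1) x₁ x₂).low m = _
  refine tsum_eq_sum fun n hn => ?_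
  rw [Finset.mem_range, not_lt] at hn
  exact neumannExp_orderGe nbar ε c₀ G V H.posOrder (n + 1) x₁ x₂ m (by omega)

omit [Nonempty T] in
/-- the regions of `W^{(j)}(X; x₁, x₂)` contain the home cube. [cite: BalabanImbrieJaffe1988, (5.7.7) p.290] -/
theorem wExp_rooted (x₁ x₂ : T) : Rooted c₀ (wExp nbar ε c₀ G V x₁ x₂) := by
  intro X hX
  by_contra hc
  apply hX
  show ∑' n : ℕ, (neumannExp nbar ε c₀ G V (n + 1) x₁ x₂).act X = 0
  rw [tsum_congr fun n => ?_, tsum_zero]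
  by_contra h
  exact hc (neumannExp_rooted nbar ε c₀ G V H.rooted (n + 1) x₁ x₂ X h)

omit [Nonempty T] in
/-- *"As always, X is a connected union of L^{k−j}r(e_k)-cubes"* (p. 294) for the regions of `W^{(j)}`.
[cite: BalabanImbrieJaffe1988, (5.7.7) p.290] -/
theorem wExp_conn {R : ι → ι → Prop} (hVc : ∀ y y', Conn R (V y y')) (x₁ x₂ : T) :
    Conn R (wExp nbar ε c₀ G V x₁ x₂) := by
  intro X hX
  by_contra hc
  apply hX
  show ∑' n : ℕ, (neumannExp nbar ε c₀ G V (n + 1) x₁ x₂).act X = 0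
  rw [tsum_congr fun n => ?_, tsum_zero]
  by_contra h
  exact hc (neumannExp_conn nbar ε c₀ G V H.rooted hVc (n + 1) x₁ x₂ X h)

/-- **THE KERNEL BOUND**: `‖W^{(j)}(X; x₁, x₂)‖ ≤ γg(qℓ + a)/(1−θ)²·e^{−κ|X|⁻}`, `q = (|e_j|/ρ)^{n̄+1}`, `θ = g(ℓ + a)` — the localized
part is as small as the overflow factor `q` and the size `a` of the `V_j(X)` allow, uniformly summed over the Neumann series.
[cite: BalabanImbrieJaffe1988, (5.7.7) p.290] -/
theorem norm_wExp_act_le (x₁ x₂ : T) (X : Finset ι) :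
    ‖(wExp nbar ε c₀ G V x₁ x₂).act X‖ ≤
      γ * (g * ((|ε| / ρ) ^ (nbar + 1) * ℓ + a)) / (1 - g * (ℓ + a)) ^ 2 *
        Real.exp (-κ * (cubePolymers ι).cardMinus X) := by
  set C := γ * (g * ((|ε| / ρ) ^ (nbar + 1) * ℓ + a)) with hC
  set w := Real.exp (-κ * (cubePolymers ι).cardMinus X) with hw
  have hmaj := H.norm_act_term_le x₁ x₂ X
  have hs : Summable fun n : ℕ => ((n : ℝ) + 1) * (g * (ℓ + a)) ^ n * C * w :=
    (H.hasSum_majorant.summable.mul_right _).mul_right _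
  show ‖∑' n : ℕ, (neumannExp nbar ε c₀ G V (n + 1) x₁ x₂).act X‖ ≤ C / (1 - g * (ℓ + a)) ^ 2 * w
  calc ‖∑' n : ℕ, (neumannExp nbar ε c₀ G V (n + 1) x₁ x₂).act X‖
      ≤ ∑' n : ℕ, ‖(neumannExp nbar ε c₀ G V (n + 1) x₁ x₂).act X‖ :=
        norm_tsum_le_tsum_norm (Summable.of_nonneg_of_le (fun _ => norm_nonneg _) hmaj hs)
    _ ≤ ∑' n : ℕ, ((n : ℝ) + 1) * (g * (ℓ + a)) ^ n * C * w :=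
        Summable.tsum_le_tsum hmaj (Summable.of_nonneg_of_le (fun _ => norm_nonneg _) hmaj hs) hs
    _ = (∑' n : ℕ, ((n : ℝ) + 1) * (g * (ℓ + a)) ^ n) * C * w := by rw [tsum_mul_right, tsum_mul_right]
    _ = C / (1 - g * (ℓ + a)) ^ 2 * w := by rw [H.hasSum_majorant.tsum_eq]; ring

/-- **p. 290, THE PRINTED SHAPE** *"with |W^{(j)}(X; x₁, x₂)| ≦ e_j^{n̄+1−α}e^{−cr(e_k)|X|⁻}"*: under the displayed constants
inequality `γg(qℓ + a)/(1−θ)² ≤ e_j^{n̄+1−α′}` (generic-constant reading: `q = (e_j/ρ)^{n̄+1}`, `a` = the size of the `V_j(X)`,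
itself of order `e_j^{n̄+1−α}` by 2b/1a). [cite: BalabanImbrieJaffe1988, (5.7.7) p.290] -/
theorem norm_wExp_act_le_printed {α' : ℝ}
    (hconst : γ * (g * ((|ε| / ρ) ^ (nbar + 1) * ℓ + a)) / (1 - g * (ℓ + a)) ^ 2 ≤ ε ^ ((nbar : ℝ) + 1 - α'))
    (x₁ x₂ : T) (X : Finset ι) :
    ‖(wExp nbar ε c₀ G V x₁ x₂).act X‖ ≤ ε ^ ((nbar : ℝ) + 1 - α') * Real.exp (-κ * (cubePolymers ι).cardMinus X) :=
  (H.norm_wExp_act_le x₁ x₂ X).trans (mul_le_mul_of_nonneg_right hconst (Real.exp_pos _).le)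

section Val

variable [DecidableEq T]

/-- **THE SPLIT OF THE PROPAGATOR SERIES** — *"We insert the expansion for V_j into this formula […] Thus we have written the
interaction term […] as W^{(j)} = W^{(j,n̄)} + Σ_X W^{(j)}(X)"*: `Σ_{n≥1} (G(V̂G)ⁿ)(x₁,x₂) = lowVal (wExp x₁ x₂) + Σ_X act X (wExp x₁ x₂)`.
[cite: BalabanImbrieJaffe1988, (5.7.7) p.290] -/
theorem val_wExp (x₁ x₂ : T) :
    (wExp nbar ε c₀ G V x₁ x₂).val nbar ε =
      ∑' n : ℕ, (Matrix.of G * (valMatrix nbar ε V * Matrix.of G) ^ (n + 1)) x₁ x₂ := by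
  have hl := H.summable_low x₁ x₂
  have ha' := H.summable_act x₁ x₂
  calc (wExp nbar ε c₀ G V x₁ x₂).val nbar ε
      = (∑' n : ℕ, ∑ m ∈ range (nbar + 1), (ε : ℂ) ^ m * (neumannExp nbar ε c₀ G V (n + 1) x₁ x₂).low m) +
          ∑' n : ℕ, ∑ X, (neumannExp nbar ε c₀ G V (n + 1) x₁ x₂).act X := by
        unfold GLExp.val GLExp.lowVal GLExp.actVal wExp
        rw [Summable.tsum_finsetSum (fun m _ => (hl m).mul_left _), Summable.tsum_finsetSum fun X _ => ha' X]
        simp only [tsum_mul_left]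
    _ = ∑' n : ℕ, (neumannExp nbar ε c₀ G V (n + 1) x₁ x₂).val nbar ε := by
        rw [← Summable.tsum_add (summable_sum fun m _ => (hl m).mul_left _) (summable_sum fun X _ => ha' X)]
        rfl
    _ = ∑' n : ℕ, (Matrix.of G * (valMatrix nbar ε V * Matrix.of G) ^ (n + 1)) x₁ x₂ :=
        tsum_congr fun n => val_neumannExp nbar ε c₀ G V (n + 1) x₁ x₂

/-- **`W^{(j)} = W^{(j,n̄)} + Σ_X W^{(j)}(X)` for the propagator series, assembled**: the series equals its order-`1 … n̄` part
plus the sum of its localized parts, the latter rooted, connected (given connected `V_j(X)`) and bounded as printed.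
[cite: BalabanImbrieJaffe1988, (5.7.7) p.290] -/
theorem w_split (x₁ x₂ : T) :
    (∑' n : ℕ, (Matrix.of G * (valMatrix nbar ε V * Matrix.of G) ^ (n + 1)) x₁ x₂) =
        (wExp nbar ε c₀ G V x₁ x₂).lowVal nbar ε + ∑ X, (wExp nbar ε c₀ G V x₁ x₂).act X ∧
      (wExp nbar ε c₀ G V x₁ x₂).low 0 = 0 ∧ Rooted c₀ (wExp nbar ε c₀ G V x₁ x₂) :=
  ⟨(H.val_wExp x₁ x₂).symm, H.wExp_low_zero x₁ x₂, H.wExp_rooted x₁ x₂⟩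

end Val

end Hyps

end Series

end Literature.MathematicalPhysics.QuantumFieldTheory.BalabanImbrieJaffe1984to88.BIJ88WSplit290

end
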